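import Summits.Ventures.PercRepro.ProfilePointedCircuitClassesReplacementUnit

/-!
# PercRepro — EVERY DEMAND HAS THREE REPLACEMENT UNITS (`n = 10`, `ρ = 6`, no coloops)
(p5, gen 46; `proofs/P5-GM1.md` §68)

On a coloop-free matroid with `10` points and rank `6`, every bi-independent `4`-set `X ∋ e` has at least THREE
bi-independent `5`-sets `T ⊇ X − e` avoiding `e` (`three_le_card_filter_replacement`).  With `A := X − e`,
`B := E ∖ X` (a basis) and `b` a point of the fundamental circuit of `e` in `B` outside `cl A`: the partners
`P₁ := {g ∈ B : g ∉ cl(A + b)}` number at least `2` (at most `4` points of the basis `B` lie in the rank-`4` flat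
`cl(A + b)`; `two_le_card_filter_notMem_clF_insert`), each giving the unit `A + b + g`
(`insert_insert_erase_mem_biIndepSets_five`).  If there are three partners we are done; otherwise `P₁ = {p₁, p₂}`,
and then `e ∉ cl(A + b)` (else `E − p₁ ⊆ cl(A + b) + p₂` would have rank `≤ 5` and `p₁` would be a coloop), so the
fundamental circuit has a second point `b₂ ∉ cl(A + b)`, whose partners give a third unit `A + b₂ + g` with `g ≠ b`.
The bound `3` is sharp (census: attained), and it is exactly what the per-set inequality (PS) for two-point sets
needs (ProfilePointedCircuitClassesReplacementPair).
-/

open scoped Matroid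

namespace PercRepro.Cogirth

open Finset ThmH Skew Shadow Profile

variable {α : Type} [DecidableEq α] {N : Matroid α} [N.Finite]

section ReplacementThree

/-- **THE REPLACEMENT UNIT LEMMA**: for `X ∈ BI_4` with `e ∈ X`, `B := E ∖ X`, a point `b` of the fundamental
circuit of `e` in `B` outside `cl(X − e)` and a point `g ∈ B` outside `cl(X − e + b)`, the set
`T = (X − e) + b + g` is a bi-independent `5`-set avoiding `e`. -/
theorem insert_insert_erase_mem_biIndepSets_five (hn : (gr N).card = rk N (gr N) + 4) {X : Finset α}
    (hX : X ∈ biIndepSets N 4) {e : α} (he : e ∈ X) {b g : α} (hb : b ∈ fundC N (gr N \ X) e)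
    (hbA : b ∉ clF N (X.erase e)) (hg : g ∈ gr N \ X) (hgcl : g ∉ clF N (insert b (X.erase e))) :
    insert g (insert b (X.erase e)) ∈ biIndepSets N 5 ∧ e ∉ insert g (insert b (X.erase e)) := by
  obtain ⟨hXg, hX4, hXrk, hXc⟩ := mem_biIndepSets.1 hX
  have heg : e ∈ gr N := hXg he
  have hBg : gr N \ X ⊆ gr N := sdiff_subset
  have hBcard : (gr N \ X).card = rk N (gr N) := by
    rw [card_sdiff_of_subset hXg, hX4]
    omega
  have heB : e ∉ gr N \ X := fun h => (mem_sdiff.1 h).2 he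
  have hAg : X.erase e ⊆ gr N := (erase_subset _ _).trans hXg
  have hArk : rk N (X.erase e) = (X.erase e).card :=
    rk_eq_card_of_subset_of_rk_eq_card (erase_subset _ _) hXrk
  have hA3 : (X.erase e).card = 3 := by rw [card_erase_of_mem he, hX4]
  have hbB : b ∈ gr N \ X := fundC_subset _ e hb
  have hbg : b ∈ gr N := hBg hbB
  have hbX : b ∉ X := (mem_sdiff.1 hbB).2
  have hbA' : b ∉ X.erase e := fun h => hbX (mem_of_mem_erase h)
  have heb : e ≠ b := fun h => hbX (h ▸ he)
  have heBb : e ∉ clF N ((gr N \ X).erase b) := by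
    unfold fundC at hb
    exact (mem_filter.1 hb).2
  have hA1g : insert b (X.erase e) ⊆ gr N := insert_subset hbg hAg
  have hA1rk : rk N (insert b (X.erase e)) = 4 := by
    rw [rk_insert_eq hbg hAg, if_neg hbA, hArk, hA3]
  have hA1card : (insert b (X.erase e)).card = 4 := by rw [card_insert_of_notMem hbA', hA3]
  have hgg : g ∈ gr N := hBg hg
  have hgX : g ∉ X := (mem_sdiff.1 hg).2
  have hgA1 : g ∉ insert b (X.erase e) := fun h => hgcl (subset_clF hA1g h)
  have heg' : e ≠ g := fun h => hgX (h ▸ he)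
  refine ⟨?_, ?_⟩
  · rw [mem_biIndepSets]
    refine ⟨insert_subset hgg hA1g, ?_, ?_, ?_⟩
    · rw [card_insert_of_notMem hgA1, hA1card]
    · rw [card_insert_of_notMem hgA1, rk_insert_eq hgg hA1g, if_neg hgcl, hA1rk, hA1card]
    · -- the complement lies in the independent set `(B − b) + e`
      have hBe : (gr N \ X).erase b ⊆ gr N := (erase_subset _ _).trans hBg
      have heBe : e ∉ (gr N \ X).erase b := fun h => heB (mem_of_mem_erase h)
      have hI : rk N (insert e ((gr N \ X).erase b)) = (insert e ((gr N \ X).erase b)).card := by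
        rw [rk_insert_eq heg hBe, if_neg heBb, card_insert_of_notMem heBe,
          rk_eq_card_of_subset_of_rk_eq_card (erase_subset _ _) hXc]
      apply rk_eq_card_of_subset_of_rk_eq_card _ hI
      intro x hx
      rw [mem_sdiff] at hx
      obtain ⟨hxg, hxT⟩ := hx
      rw [mem_insert]
      by_cases hxe : x = e
      · exact Or.inl hxe
      · right
        rw [mem_erase, mem_sdiff]
        refine ⟨?_, hxg, ?_⟩
        · intro hxb
          rw [hxb] at hxT
          exact hxT (mem_insert_of_mem (mem_insert_self b _))
        · intro hxX
          exact hxT (mem_insert_of_mem (mem_insert_of_mem (mem_erase.2 ⟨hxe, hxX⟩)))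
  · rw [mem_insert, mem_insert]
    rintro (h | h | h)
    · exact heg' h
    · exact heb h
    · exact (mem_erase.1 h).1 rfl

/-- **AT LEAST TWO PARTNERS**: on `#E = 10`, `ρ = 6`, for `X ∈ BI_4`, `e ∈ X` and a point `b ∈ E` outside
`cl(X − e)`, at least two points of the basis `B = E ∖ X` lie outside the rank-`4` flat `cl(X − e + b)`
(at most four points of the independent set `B` can lie in it). -/
theorem two_le_card_filter_notMem_clF_insert (hn : (gr N).card = 10) {X : Finset α}
    (hX : X ∈ biIndepSets N 4) {e : α} (he : e ∈ X) {b : α} (hbg : b ∈ gr N) (hbA : b ∉ clF N (X.erase e)) :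
    2 ≤ ((gr N \ X).filter (fun x => x ∉ clF N (insert b (X.erase e)))).card := by
  obtain ⟨hXg, hX4, hXrk, hXc⟩ := mem_biIndepSets.1 hX
  have hBcard : (gr N \ X).card = 6 := by rw [card_sdiff_of_subset hXg, hX4, hn]
  have hAg : X.erase e ⊆ gr N := (erase_subset _ _).trans hXg
  have hArk : rk N (X.erase e) = (X.erase e).card :=
    rk_eq_card_of_subset_of_rk_eq_card (erase_subset _ _) hXrk
  have hA3 : (X.erase e).card = 3 := by rw [card_erase_of_mem he, hX4]
  have hA1rk : rk N (insert b (X.erase e)) = 4 := by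
    rw [rk_insert_eq hbg hAg, if_neg hbA, hArk, hA3]
  have hS : ((gr N \ X).filter (fun x => x ∈ clF N (insert b (X.erase e)))).card ≤ 4 := by
    have h1 : rk N ((gr N \ X).filter (fun x => x ∈ clF N (insert b (X.erase e)))) =
        ((gr N \ X).filter (fun x => x ∈ clF N (insert b (X.erase e)))).card :=
      rk_eq_card_of_subset_of_rk_eq_card (filter_subset _ _) hXc
    have h2 : (gr N \ X).filter (fun x => x ∈ clF N (insert b (X.erase e))) ⊆
        clF N (insert b (X.erase e)) := fun x hx => (mem_filter.1 hx).2
    have h3 := rk_le_rk_of_subset_finset (M := N) h2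
    rw [rk_clF_eq_rk, hA1rk] at h3
    omega
  have hsplit := card_filter_add_card_filter_not (s := gr N \ X)
    (p := fun x => x ∈ clF N (insert b (X.erase e)))
  omega

/-- Three distinct members of a finset give `3 ≤ #s`. -/
theorem three_le_card_of_three_mem {β : Type} [DecidableEq β] {s : Finset β} {a b c : β} (ha : a ∈ s)
    (hb : b ∈ s) (hc : c ∈ s) (hab : a ≠ b) (hac : a ≠ c) (hbc : b ≠ c) : 3 ≤ s.card := by
  have hsub : insert a (insert b ({c} : Finset β)) ⊆ s := by
    intro x hx
    rw [mem_insert, mem_insert, mem_singleton] at hx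
    rcases hx with rfl | rfl | rfl
    · exact ha
    · exact hb
    · exact hc
  have hcard : (insert a (insert b ({c} : Finset β))).card = 3 := by
    rw [card_insert_of_notMem, card_insert_of_notMem, card_singleton]
    · rw [mem_singleton]
      exact hbc
    · rw [mem_insert, mem_singleton]
      rintro (h | h)
      · exact hab h
      · exact hac h
  have := card_le_card hsub
  omega

/-- **EVERY DEMAND HAS THREE REPLACEMENT UNITS**: on a coloop-free matroid with `#E = 10` and `ρ = 6`, every
bi-independent `4`-set `X ∋ e` has at least three bi-independent `5`-sets `T ⊇ X − e` avoiding `e`. -/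
theorem three_le_card_filter_replacement (hn : (gr N).card = 10) (hR : rk N (gr N) = 6)
    (hcf : ∀ x ∈ gr N, rk N ((gr N).erase x) = 6) {X : Finset α} (hX : X ∈ biIndepSets N 4) {e : α}
    (he : e ∈ X) : 3 ≤ ((biIndepSets N 5).filter (fun T => e ∉ T ∧ X.erase e ⊆ T)).card := by
  have hn' : (gr N).card = rk N (gr N) + 4 := by omega
  obtain ⟨hXg, hX4, hXrk, hXc⟩ := mem_biIndepSets.1 hX
  have heg : e ∈ gr N := hXg he
  have hBg : gr N \ X ⊆ gr N := sdiff_subset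
  have hBcard : (gr N \ X).card = 6 := by rw [card_sdiff_of_subset hXg, hX4, hn]
  have hBrk : rk N (gr N \ X) = rk N (gr N) := by rw [hXc, hBcard, hR]
  have hecl : e ∈ clF N (gr N \ X) := by
    rw [mem_clF_iff_rk_insert_eq heg hBg]
    have h1 := rk_le_rk_gr (M := N) (insert_subset heg hBg)
    have h2 := rk_le_rk_of_subset_finset (M := N) (subset_insert e (gr N \ X))
    omega
  have hAg : X.erase e ⊆ gr N := (erase_subset _ _).trans hXg
  have heA : e ∉ clF N (X.erase e) := notMem_clF_erase_of_indep (indep_of_rk_eq_card' hXrk) he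
  have hCcl : e ∈ clF N (fundC N (gr N \ X) e) := mem_clF_fundC heg hBg hXc hecl
  -- the first point `b` of the fundamental circuit outside `cl A`
  obtain ⟨b, hbC, hbA⟩ : ∃ b ∈ fundC N (gr N \ X) e, b ∉ clF N (X.erase e) := by
    by_contra hcon
    have hsub : fundC N (gr N \ X) e ⊆ clF N (X.erase e) :=
      fun x hx => by_contra (fun h => hcon ⟨x, hx, h⟩)
    exact heA (mem_clF_of_mem_clF_clF hAg (mem_clF_of_subset hsub hCcl))
  have hbB : b ∈ gr N \ X := fundC_subset _ e hbC
  have hbg : b ∈ gr N := hBg hbB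
  have hbA' : b ∉ X.erase e := fun h => (mem_sdiff.1 hbB).2 (mem_of_mem_erase h)
  have hA1g : insert b (X.erase e) ⊆ gr N := insert_subset hbg hAg
  -- two partners of `b`
  have hP₁ := two_le_card_filter_notMem_clF_insert hn hX he hbg hbA
  obtain ⟨p₁, hp₁, p₂, hp₂, hp⟩ := one_lt_card.1
    (by omega : 1 < ((gr N \ X).filter (fun x => x ∉ clF N (insert b (X.erase e)))).card)
  rw [mem_filter] at hp₁ hp₂
  have hT₁ := insert_insert_erase_mem_biIndepSets_five hn' hX he hbC hbA hp₁.1 hp₁.2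
  have hT₂ := insert_insert_erase_mem_biIndepSets_five hn' hX he hbC hbA hp₂.1 hp₂.2
  have hp₁A1 : p₁ ∉ insert b (X.erase e) := fun h => hp₁.2 (subset_clF hA1g h)
  have hp₂A1 : p₂ ∉ insert b (X.erase e) := fun h => hp₂.2 (subset_clF hA1g h)
  have h12 : insert p₁ (insert b (X.erase e)) ≠ insert p₂ (insert b (X.erase e)) := by
    intro h
    have : p₁ ∈ insert p₂ (insert b (X.erase e)) := h ▸ mem_insert_self p₁ _
    rw [mem_insert] at this
    rcases this with h' | h'
    · exact hp h'
    · exact hp₁A1 h'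
  have hm₁ : insert p₁ (insert b (X.erase e)) ∈
      (biIndepSets N 5).filter (fun T => e ∉ T ∧ X.erase e ⊆ T) :=
    mem_filter.2 ⟨hT₁.1, hT₁.2, fun x hx => mem_insert_of_mem (mem_insert_of_mem hx)⟩
  have hm₂ : insert p₂ (insert b (X.erase e)) ∈
      (biIndepSets N 5).filter (fun T => e ∉ T ∧ X.erase e ⊆ T) :=
    mem_filter.2 ⟨hT₂.1, hT₂.2, fun x hx => mem_insert_of_mem (mem_insert_of_mem hx)⟩
  by_cases h3 : ∃ p₃ ∈ (gr N \ X).filter (fun x => x ∉ clF N (insert b (X.erase e))), p₃ ≠ p₁ ∧ p₃ ≠ p₂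
  · -- three partners of `b`
    obtain ⟨p₃, hp₃, hp₃₁, hp₃₂⟩ := h3
    rw [mem_filter] at hp₃
    have hT₃ := insert_insert_erase_mem_biIndepSets_five hn' hX he hbC hbA hp₃.1 hp₃.2
    have hp₃A1 : p₃ ∉ insert b (X.erase e) := fun h => hp₃.2 (subset_clF hA1g h)
    have hm₃ : insert p₃ (insert b (X.erase e)) ∈
        (biIndepSets N 5).filter (fun T => e ∉ T ∧ X.erase e ⊆ T) :=
      mem_filter.2 ⟨hT₃.1, hT₃.2, fun x hx => mem_insert_of_mem (mem_insert_of_mem hx)⟩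
    have h13 : insert p₁ (insert b (X.erase e)) ≠ insert p₃ (insert b (X.erase e)) := by
      intro h
      have : p₁ ∈ insert p₃ (insert b (X.erase e)) := h ▸ mem_insert_self p₁ _
      rw [mem_insert] at this
      rcases this with h' | h'
      · exact hp₃₁ h'.symm
      · exact hp₁A1 h'
    have h23 : insert p₂ (insert b (X.erase e)) ≠ insert p₃ (insert b (X.erase e)) := by
      intro h
      have : p₂ ∈ insert p₃ (insert b (X.erase e)) := h ▸ mem_insert_self p₂ _
      rw [mem_insert] at this
      rcases this with h' | h'
      · exact hp₃₂ h'.symm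
      · exact hp₂A1 h'
    exact three_le_card_of_three_mem hm₁ hm₂ hm₃ h12 h13 h23
  · -- only two partners: then `e ∉ cl(A + b)`, else `p₁` would be a coloop
    have hecl' : e ∉ clF N (insert b (X.erase e)) := by
      intro hecl'
      have hsub : (gr N).erase p₁ ⊆ insert p₂ (clF N (insert b (X.erase e))) := by
        intro x hx
        rw [mem_erase] at hx
        obtain ⟨hxp, hxg⟩ := hx
        rw [mem_insert]
        by_cases hx2 : x = p₂
        · exact Or.inl hx2
        · right
          by_cases hxX : x ∈ X
          · by_cases hxe : x = e
            · rw [hxe]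
              exact hecl'
            · exact subset_clF hA1g (mem_insert_of_mem (mem_erase.2 ⟨hxe, hxX⟩))
          · by_contra hxcl
            exact h3 ⟨x, mem_filter.2 ⟨mem_sdiff.2 ⟨hxg, hxX⟩, hxcl⟩, hxp, hx2⟩
      have h1 := rk_le_rk_of_subset_finset (M := N) hsub
      have h2 := rk_insert_le (M := N) p₂ (clF N (insert b (X.erase e)))
      have h4 := hcf p₁ (hBg hp₁.1)
      have hA1rk : rk N (insert b (X.erase e)) = 4 := by
        have hArk : rk N (X.erase e) = (X.erase e).card :=
          rk_eq_card_of_subset_of_rk_eq_card (erase_subset _ _) hXrk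
        have hA3 : (X.erase e).card = 3 := by rw [card_erase_of_mem he, hX4]
        rw [rk_insert_eq hbg hAg, if_neg hbA, hArk, hA3]
      rw [rk_clF_eq_rk, hA1rk] at h2
      omega
    -- a second point `b₂` of the fundamental circuit outside `cl(A + b)`
    obtain ⟨b₂, hb₂C, hb₂cl⟩ : ∃ b₂ ∈ fundC N (gr N \ X) e, b₂ ∉ clF N (insert b (X.erase e)) := by
      by_contra hcon
      have hsub : fundC N (gr N \ X) e ⊆ clF N (insert b (X.erase e)) :=
        fun x hx => by_contra (fun h => hcon ⟨x, hx, h⟩)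
      exact hecl' (mem_clF_of_mem_clF_clF hA1g (mem_clF_of_subset hsub hCcl))
    have hb₂A : b₂ ∉ clF N (X.erase e) := fun h => hb₂cl (clF_mono (subset_insert b _) h)
    have hb₂b : b₂ ≠ b := fun h => hb₂cl (h ▸ subset_clF hA1g (mem_insert_self b _))
    have hb₂g : b₂ ∈ gr N := hBg (fundC_subset _ e hb₂C)
    -- a partner `g ≠ b` of `b₂`
    have hP₂ := two_le_card_filter_notMem_clF_insert hn hX he hb₂g hb₂A
    obtain ⟨q₁, hq₁, q₂, hq₂, hq⟩ := one_lt_card.1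
      (by omega : 1 < ((gr N \ X).filter (fun x => x ∉ clF N (insert b₂ (X.erase e)))).card)
    obtain ⟨g, hgP, hgb⟩ : ∃ g ∈ (gr N \ X).filter (fun x => x ∉ clF N (insert b₂ (X.erase e))), g ≠ b := by
      by_cases h : q₁ = b
      · exact ⟨q₂, hq₂, fun h' => hq (h.trans h'.symm)⟩
      · exact ⟨q₁, hq₁, h⟩
    rw [mem_filter] at hgP
    have hT₃ := insert_insert_erase_mem_biIndepSets_five hn' hX he hb₂C hb₂A hgP.1 hgP.2
    have hm₃ : insert g (insert b₂ (X.erase e)) ∈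
        (biIndepSets N 5).filter (fun T => e ∉ T ∧ X.erase e ⊆ T) :=
      mem_filter.2 ⟨hT₃.1, hT₃.2, fun x hx => mem_insert_of_mem (mem_insert_of_mem hx)⟩
    -- `A + b₂ + g` contains neither `A + b + p₁` nor `A + b + p₂`: `b` is in the latter, not in the former
    have hb₃ : b ∉ insert g (insert b₂ (X.erase e)) := by
      rw [mem_insert, mem_insert]
      rintro (h | h | h)
      · exact hgb h.symm
      · exact hb₂b h.symm
      · exact hbA' h
    have h13 : insert p₁ (insert b (X.erase e)) ≠ insert g (insert b₂ (X.erase e)) := by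
      intro h
      exact hb₃ (h ▸ mem_insert_of_mem (mem_insert_self b _))
    have h23 : insert p₂ (insert b (X.erase e)) ≠ insert g (insert b₂ (X.erase e)) := by
      intro h
      exact hb₃ (h ▸ mem_insert_of_mem (mem_insert_self b _))
    exact three_le_card_of_three_mem hm₁ hm₂ hm₃ h12 h13 h23

end ReplacementThree

end PercRepro.Cogirth
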